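import Literature.MathematicalPhysics.KineticTheory.DiPernaLionsApproxSupersolution
import HarnessLib

/-!
# Classical solutions along characteristics solve the transport equation in `𝒟'`

Topic: MathematicalPhysics / KineticTheory. Infrastructure for the named fact (L12)
`diPernaLions_limit_expDuhamel` (Cercignani–Illner–Pulvirenti 1994 §5.3 Lemma 5.3.12): the
velocity-averaging lemmas (CIP Lemmas 5.3.9–5.3.10, `velocityAverage_relativelyCompact_L1`) are
applied in the proof of Lemma 5.3.12 to renormalised and truncated approximate solutions,
"`{gₘⁿ}` satisfies the hypotheses of Lemma 5.3.9 (`Tgₘⁿ = Qₙ(fⁿ,fⁿ)` if `gₘⁿ < m`, `= 0`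
otherwise)" (p. 158), i.e. one needs the transport equation `T β(fⁿ) = β'(fⁿ) Q̃ₙ(fⁿ,fⁿ)` *in the
sense of distributions* on the open slab `(0,T) × E × E` (`HasDistribTransportOn`, the hypothesis
format of `velocityAverage_relativelyCompact_L1`). This file proves it. Everything is proved;
theorems only.

* `hasDistribTransportOn_of_hasDerivAt_shearFlow` (**classical ⇒ distributional**): if `u, h` are
  locally integrable on `(0,T) × E × E` and, along every characteristic,
  `d/ds u(s, x + s v, v) = h(s, x + s v, v)` for `s ∈ (0, T)`, then `(∂ₜ + v·∇ₓ) u = h` in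
  `𝒟'((0,T) × E × E)`: for a test function `φ`, `d/ds (u♯ φ♯) = h♯ φ♯ + u♯ (Tφ)♯` integrates to
  zero along every characteristic on which it is integrable (almost all, by Fubini in free-flow
  coordinates, `integral_eq_integral_integral_shearFlow`), and the shear `(s, x, v) ↦ (s, x + sv, v)`
  preserves Lebesgue measure.
* `IsDiPernaLionsApproximateSolution.hasDistribTransportOn_renormalised`: for an approximate
  solution `f` of the truncated equation (bounded DiPerna–Lions kernel, `δ ≥ 0`), every `β`
  differentiable on `(0, ∞)` with continuous derivative and every
  bounded measurable velocity weight `χ`,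
  `T (χ(v) β(f)) = χ(v) β'(f) Q̃_δ(f,f)` in `𝒟'((0,T) × E × E)`
  (with `exists_bound_comp_of_pos`, `IsDiPernaLionsApproximateSolution.locallyIntegrableOn_renormalised`,
  `.locallyIntegrableOn_renormalised_rhs` for the local integrability).

## References

* C. Cercignani, R. Illner, M. Pulvirenti, *The Mathematical Theory of Dilute Gases*, Springer
  (1994), §5.3 Step 4 (mild and distributional formulations, pp. 143–144), Lemma 5.3.9 (p. 154),
  proof of Lemma 5.3.12 (p. 158).
-/

open MeasureTheory Metric Real Set Filter Topology
open scoped InnerProductSpace ENNReal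

noncomputable section

namespace Literature.MathematicalPhysics.KineticTheory

open Literature.Analysis.FluidPDE

variable {E : Type*} [NormedAddCommGroup E] [InnerProductSpace ℝ E] [FiniteDimensional ℝ E]
  [MeasurableSpace E] [BorelSpace E]

/-! ## Test functions supported in an open time slab -/

omit [InnerProductSpace ℝ E] [FiniteDimensional ℝ E] [MeasurableSpace E] [BorelSpace E] in
/-- A compactly supported function whose support lies in `(0,T) × E × E` is supported in a closed
time interval `[a, b] ⊂ (0, T)`. [folklore] -/
theorem exists_time_bounds_of_tsupport_subset {T : ℝ} {φ : ℝ × E × E → ℝ}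
    (hφc : HasCompactSupport φ) (hφs : tsupport φ ⊆ Ioo 0 T ×ˢ univ)
    (hne : (tsupport φ).Nonempty) :
    ∃ a b : ℝ, 0 < a ∧ a ≤ b ∧ b < T ∧ ∀ z ∈ tsupport φ, a ≤ z.1 ∧ z.1 ≤ b := by
  have hKc : IsCompact (tsupport φ) := hφc
  obtain ⟨p₀, hp₀, hmin⟩ := hKc.exists_isMinOn hne continuous_fst.continuousOn
  obtain ⟨p₁, hp₁, hmax⟩ := hKc.exists_isMaxOn hne continuous_fst.continuousOn
  refine ⟨p₀.1, p₁.1, (mem_prod.1 (hφs hp₀)).1.1, hmin hp₁, (mem_prod.1 (hφs hp₁)).1.2,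
    fun z hz => ⟨hmin hz, hmax hz⟩⟩

omit [FiniteDimensional ℝ E] [MeasurableSpace E] [BorelSpace E] in
/-- The transport derivative `(∂ₜ + v·∇ₓ)φ` of a `C¹` function vanishes off its topological support
(local copy of the lemma of `VelocityAveragingFourier`, kept private to avoid the Fourier-side
imports). [folklore] -/
private theorem transportDeriv_eq_zero_of_notMem_tsupport' {φ : ℝ × E × E → ℝ}
    {z : ℝ × E × E} (hz : z ∉ tsupport φ) : transportDeriv φ z = 0 := by
  have h : fderiv ℝ φ z = 0 := Function.notMem_support.1 fun h => hz (support_fderiv_subset ℝ h)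
  simp [transportDeriv, h]

/-! ## Classical solutions along characteristics are distributional solutions -/

/-- **A function differentiable along characteristics solves the transport equation in `𝒟'`.**
Let `u, h` be locally integrable on the open slab `(0,T) × E × E` and suppose that along every
characteristic `s ↦ u(s, x + s v, v)` is differentiable on `(0, T)` with derivative
`h(s, x + s v, v)`. Then `(∂ₜ + v·∇ₓ) u = h` in `𝒟'((0,T) × E × E)` (`HasDistribTransportOn`):
for a test function `φ` supported in the slab, `d/ds [u♯ φ♯] = h♯ φ♯ + u♯ (Tφ)♯` along each
characteristic, whose integral over `(0, T)` vanishes (compact time support) whenever it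
converges — which is the case along almost every characteristic, by Fubini in the
measure-preserving free-flow coordinates — so that `∫ (u Tφ + h φ) = 0` (CIP 1994 §5.3 Step 4:
mild solutions are solutions in the sense of distributions). [cite: CIPDiluteGases1994, §5.3 Step 4 (pp. 143–144)] -/
theorem hasDistribTransportOn_of_hasDerivAt_shearFlow {T : ℝ} {u h : ℝ × E × E → ℝ}
    (hu : LocallyIntegrableOn u (Ioo 0 T ×ˢ univ) volume)
    (hh : LocallyIntegrableOn h (Ioo 0 T ×ˢ univ) volume)
    (hderiv : ∀ z : E × E, ∀ s ∈ Ioo 0 T,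
      HasDerivAt (fun σ => u (shearFlow (σ, z))) (h (shearFlow (s, z))) s) :
    HasDistribTransportOn (Ioo 0 T) u h := by
  refine ⟨hu, hh, fun φ hφ hφc hφs => ?_⟩
  -- the test function and its transport derivative
  have hφd : Differentiable ℝ φ := hφ.differentiable (by simp)
  have hφcont : Continuous φ := hφd.continuous
  set Dφ : ℝ × E × E → ℝ := transportDeriv φ with hDφdef
  have hDφc : Continuous Dφ :=
    (hφ.continuous_fderiv (by simp)).clm_apply (continuous_const.prodMk
      (continuous_snd.snd.prodMk continuous_const))
  set K : Set (ℝ × E × E) := tsupport φ with hKdef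
  have hKc : IsCompact K := hφc
  have hφK : ∀ z ∉ K, φ z = 0 := fun z hz => image_eq_zero_of_notMem_tsupport hz
  have hDφK : ∀ z ∉ K, Dφ z = 0 := fun z hz => transportDeriv_eq_zero_of_notMem_tsupport' hz
  -- the empty-support case
  rcases K.eq_empty_or_nonempty with hKe | hKne
  · have h1 : (fun z => u z * transportDeriv φ z) = fun _ => 0 := by
      funext z; rw [show transportDeriv φ z = Dφ z from rfl, hDφK z (by simp [hKe]), mul_zero]
    have h2 : (fun z => h z * φ z) = fun _ => 0 := by
      funext z; rw [hφK z (by simp [hKe]), mul_zero]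
    rw [h1, h2]
    simp
  obtain ⟨a, b, ha, hab, hbT, hKt⟩ := exists_time_bounds_of_tsupport_subset hφc hφs hKne
  -- the combined integrand `G = u Tφ + h φ`, supported in `K`, integrable
  set G : ℝ × E × E → ℝ := fun z => u z * Dφ z + h z * φ z with hGdef
  have huK : IntegrableOn u K volume := hu.integrableOn_compact_subset hφs hKc
  have hhK : IntegrableOn h K volume := hh.integrableOn_compact_subset hφs hKc
  have h1K : IntegrableOn (fun z => u z * Dφ z) K volume :=
    huK.mul_continuousOn hDφc.continuousOn hKc
  have h2K : IntegrableOn (fun z => h z * φ z) K volume :=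
    hhK.mul_continuousOn hφcont.continuousOn hKc
  have h1 : Integrable (fun z => u z * Dφ z) volume :=
    h1K.integrable_of_forall_notMem_eq_zero fun z hz => by rw [hDφK z hz, mul_zero]
  have h2 : Integrable (fun z => h z * φ z) volume :=
    h2K.integrable_of_forall_notMem_eq_zero fun z hz => by rw [hφK z hz, mul_zero]
  have hG : Integrable G volume := h1.add h2
  have hGK : ∀ z ∉ K, G z = 0 := fun z hz => by
    simp only [hGdef, hφK z hz, hDφK z hz, mul_zero, add_zero]
  -- `∫ G = 0`: pass to free-flow coordinates and integrate along characteristics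
  have hGint : ∫ z, G z = 0 := by
    set S : Set (ℝ × E × E) := Ioi 0 ×ˢ univ with hSdef
    have hKS : K ⊆ S := fun z hz => ⟨(mem_prod.1 (hφs hz)).1.1, mem_univ _⟩
    have hGS : Integrable G (volume.restrict S) := hG.restrict
    have hstep1 : ∫ z, G z = ∫ z, G z ∂(volume.restrict S) := by
      refine (setIntegral_eq_integral_of_forall_compl_eq_zero fun z hz => hGK z ?_).symm
      exact fun hzK => hz (hKS hzK)
    rw [hstep1, integral_eq_integral_integral_shearFlow hGS]
    refine integral_eq_zero_of_ae ?_
    filter_upwards [ae_integrableOn_shearFlow hGS] with zz hzz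
    -- along the characteristic through `zz`
    set a' : ℝ := a / 2 with ha'
    set b' : ℝ := (b + T) / 2 with hb'
    have ha'0 : 0 < a' := by rw [ha']; linarith
    have ha'a : a' < a := by rw [ha']; linarith
    have hbb' : b < b' := by rw [hb']; linarith
    have hb'T : b' < T := by rw [hb']; linarith
    have ha'b' : a' ≤ b' := by linarith
    -- `G♯` vanishes outside `[a, b]`
    have hGsharp_zero : ∀ t, t ∉ Icc a b → G (shearFlow (t, zz)) = 0 := by
      intro t ht
      refine hGK _ fun hK => ht ?_
      have := hKt _ hK
      simpa [shearFlow] using this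
    -- the product `w = u♯ φ♯` and its derivative
    set w : ℝ → ℝ := fun t => u (shearFlow (t, zz)) * φ (shearFlow (t, zz)) with hwdef
    have hw_deriv : ∀ t ∈ Ioo 0 T, HasDerivAt w (G (shearFlow (t, zz))) t := by
      intro t ht
      have hu' := hderiv zz t ht
      have hφ' : HasDerivAt (fun σ => φ (shearFlow (σ, zz))) (Dφ (shearFlow (t, zz))) t := by
        have := hasDerivAt_comp_characteristic hφd zz.1 zz.2 t
        simpa [shearFlow, hDφdef, transportDeriv] using this
      refine (hu'.mul hφ').congr_deriv ?_
      simp only [hGdef]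
      ring
    have hw_zero : ∀ t, t ∉ Icc a b → w t = 0 := by
      intro t ht
      simp only [hwdef]
      rw [hφK _ fun hK => ht ?_, mul_zero]
      have := hKt _ hK
      simpa [shearFlow] using this
    -- FTC on `[a', b']`
    have hzz' : IntegrableOn (fun t => G (shearFlow (t, zz))) (Ioi 0) volume := hzz
    have hint : IntervalIntegrable (fun t => G (shearFlow (t, zz))) volume a' b' := by
      rw [intervalIntegrable_iff_integrableOn_Ioc_of_le ha'b']
      exact hzz'.mono_set fun t ht => (ha'0.trans ht.1 : (0 : ℝ) < t)
    have hFTC : ∫ t in a'..b', G (shearFlow (t, zz)) = w b' - w a' :=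
      intervalIntegral.integral_eq_sub_of_hasDerivAt
        (fun t ht => hw_deriv t ⟨ha'0.trans_le (by rw [uIcc_of_le ha'b'] at ht; exact ht.1),
          lt_of_le_of_lt (by rw [uIcc_of_le ha'b'] at ht; exact ht.2) hb'T⟩) hint
    rw [hw_zero b' fun h => (not_lt.2 h.2) hbb', hw_zero a' fun h => (not_lt.2 h.1) ha'a,
      sub_zero] at hFTC
    -- the integral over `(0, ∞)` is the integral over `[a', b']`
    calc ∫ t in Ioi (0 : ℝ), G (shearFlow (t, zz))
        = ∫ t in Ioc a' b', G (shearFlow (t, zz)) := by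
          refine setIntegral_eq_of_subset_of_forall_sdiff_eq_zero measurableSet_Ioi
            (Ioc_subset_Ioi_self.trans (Ioi_subset_Ioi ha'0.le)) fun t ht => hGsharp_zero t fun htab => ?_
          exact ht.2 ⟨ha'a.trans_le htab.1, htab.2.trans hbb'.le⟩
      _ = ∫ t in a'..b', G (shearFlow (t, zz)) := (intervalIntegral.integral_of_le ha'b').symm
      _ = 0 := hFTC
  -- conclude
  have hsplit : ∫ z, G z = (∫ z, u z * Dφ z) + ∫ z, h z * φ z := integral_add h1 h2
  rw [hGint] at hsplit
  show ∫ z, u z * transportDeriv φ z = -∫ z, h z * φ z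
  linarith

/-! ## Application: renormalised approximate solutions -/

section Approx

variable {δ : ℝ} {B : E × E → sphere (0 : E) 1 → ℝ} {f : ℝ → E → E → ℝ}

/-- A function continuous on `(0, ∞)` is bounded on the (positive) values taken by a continuous
function on a compact set. [folklore] -/
theorem exists_bound_comp_of_pos {X : Type*} [TopologicalSpace X] {K : Set X} (hK : IsCompact K)
    {g : X → ℝ} (hg : ContinuousOn g K) (hpos : ∀ z ∈ K, 0 < g z) {β : ℝ → ℝ}
    (hβ : ContinuousOn β (Ioi 0)) : ∃ C : ℝ, ∀ z ∈ K, |β (g z)| ≤ C := by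
  have hIc : IsCompact (g '' K) := hK.image_of_continuousOn hg
  have hI : g '' K ⊆ Ioi 0 := by
    rintro _ ⟨z, hz, rfl⟩; exact hpos z hz
  obtain ⟨C, hC⟩ := hIc.exists_bound_of_continuousOn (hβ.mono hI)
  exact ⟨C, fun z hz => by simpa [Real.norm_eq_abs] using hC (g z) ⟨z, hz, rfl⟩⟩

omit [InnerProductSpace ℝ E] [FiniteDimensional ℝ E] [MeasurableSpace E] [BorelSpace E] in
/-- Compact subsets of the open slab `(0,T) × E × E` lie in `[0, T'] × E × E` for some `T' ≥ 0`
and consist of points with positive time. [folklore] -/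
theorem exists_Icc_of_isCompact_subset_slab {T : ℝ} {K : Set (ℝ × E × E)} (hKc : IsCompact K)
    (hKS : K ⊆ Ioo 0 T ×ˢ univ) :
    ∃ T' : ℝ, 0 ≤ T' ∧ ∀ z ∈ K, 0 < z.1 ∧ z.1 ∈ Icc 0 T' := by
  rcases K.eq_empty_or_nonempty with hKe | hKne
  · exact ⟨0, le_rfl, fun z hz => by simp [hKe] at hz⟩
  obtain ⟨p₁, hp₁, hmax⟩ := hKc.exists_isMaxOn hKne continuous_fst.continuousOn
  have h1 : 0 < p₁.1 := (mem_prod.1 (hKS hp₁)).1.1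
  exact ⟨p₁.1, h1.le, fun z hz => ⟨(mem_prod.1 (hKS hz)).1.1, (mem_prod.1 (hKS hz)).1.1.le, hmax hz⟩⟩

/-- **Local integrability of renormalised approximate solutions**: for an approximate solution
`f`, `β` continuous on `(0, ∞)` and a bounded measurable velocity weight `χ`, the function
`χ(v) β(f(t,x,v))` is locally integrable on the open slab `(0,T) × E × E` (it is bounded and
measurable on every compact subset). [folklore] -/
theorem IsDiPernaLionsApproximateSolution.locallyIntegrableOn_renormalised
    (hf : IsDiPernaLionsApproximateSolution δ B f) {β : ℝ → ℝ} (hβ : ContinuousOn β (Ioi 0))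
    {χ : E → ℝ} (hχm : Measurable χ) {Cχ : ℝ} (hχ : ∀ v, |χ v| ≤ Cχ) (T : ℝ) :
    LocallyIntegrableOn (fun z : ℝ × E × E => χ z.2.2 * β (f z.1 z.2.1 z.2.2)) (Ioo 0 T ×ˢ univ)
      volume := by
  rw [locallyIntegrableOn_iff (isOpen_Ioo.prod isOpen_univ).isLocallyClosed]
  intro K hKS hKc
  -- the clamped renormalised density is continuous
  have hfc : Continuous fun z : ℝ × E × E => f (max z.1 0) z.2.1 z.2.2 :=
    hf.continuous_clamp continuous_fst continuous_snd.fst continuous_snd.snd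
  have hβfc : Continuous fun z : ℝ × E × E => β (f (max z.1 0) z.2.1 z.2.2) :=
    hβ.comp_continuous hfc fun z => hf.pos _ (le_max_right _ _) _ _
  have hmeas : Measurable fun z : ℝ × E × E => χ z.2.2 * β (f (max z.1 0) z.2.1 z.2.2) :=
    (hχm.comp measurable_snd.snd).mul hβfc.measurable
  -- bound on `K`
  obtain ⟨Cβ, hCβ⟩ := exists_bound_comp_of_pos hKc (hfc.continuousOn) (fun z _ => hf.pos _ (le_max_right _ _) _ _) hβ
  have hKfin : volume K < ∞ := hKc.measure_lt_top
  have hint : IntegrableOn (fun z : ℝ × E × E => χ z.2.2 * β (f (max z.1 0) z.2.1 z.2.2)) K volume := by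
    refine Measure.integrableOn_of_bounded hKfin.ne hmeas.aestronglyMeasurable ?_ (M := |Cχ| * |Cβ|)
    refine (ae_restrict_mem hKc.measurableSet).mono fun z hz => ?_
    rw [Real.norm_eq_abs, abs_mul]
    exact mul_le_mul ((hχ _).trans (le_abs_self _)) ((hCβ z hz).trans (le_abs_self _))
      (abs_nonneg _) (abs_nonneg _)
  refine hint.congr_fun (fun z hz => ?_) hKc.measurableSet
  beta_reduce
  rw [max_eq_left (mem_prod.1 (hKS hz)).1.1.le]

/-- **Local integrability of the renormalised right-hand side**: for an approximate solution `f`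
with a bounded nonnegative measurable kernel, `δ ≥ 0`, `β'` continuous on `(0, ∞)` and a bounded
measurable velocity weight `χ`, the function `χ(v) β'(f) Q̃_δ(f,f)` is locally integrable on the
open slab `(0,T) × E × E`. [folklore] -/
theorem IsDiPernaLionsApproximateSolution.locallyIntegrableOn_renormalised_rhs
    (hf : IsDiPernaLionsApproximateSolution δ B f) (hBm : Measurable (Function.uncurry B))
    (hB0 : ∀ p ω, 0 ≤ B p ω) {Cb : ℝ} (hCb : ∀ p ω, B p ω ≤ Cb) (hδ : 0 ≤ δ) {β' : ℝ → ℝ}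
    (hβ' : ContinuousOn β' (Ioi 0)) {χ : E → ℝ} (hχm : Measurable χ) {Cχ : ℝ}
    (hχ : ∀ v, |χ v| ≤ Cχ) (T : ℝ) :
    LocallyIntegrableOn (fun z : ℝ × E × E =>
      χ z.2.2 * (β' (f z.1 z.2.1 z.2.2) * truncatedCollisionOp δ B (f z.1 z.2.1) z.2.2))
      (Ioo 0 T ×ˢ univ) volume := by
  rw [locallyIntegrableOn_iff (isOpen_Ioo.prod isOpen_univ).isLocallyClosed]
  intro K hKS hKc
  obtain ⟨T', hT', hKT'⟩ := exists_Icc_of_isCompact_subset_slab hKc hKS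
  -- measurability through the clamp
  have hfc : Continuous fun z : ℝ × E × E => f (max z.1 0) z.2.1 z.2.2 :=
    hf.continuous_clamp continuous_fst continuous_snd.fst continuous_snd.snd
  have hβfc : Continuous fun z : ℝ × E × E => β' (f (max z.1 0) z.2.1 z.2.2) :=
    hβ'.comp_continuous hfc fun z => hf.pos _ (le_max_right _ _) _ _
  have hQm := hf.measurable_truncatedCollisionOp_clamp hBm
  have hmeas : Measurable fun z : ℝ × E × E => χ z.2.2 *
      (β' (f (max z.1 0) z.2.1 z.2.2) * truncatedCollisionOp δ B (f (max z.1 0) z.2.1) z.2.2) :=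
    (hχm.comp measurable_snd.snd).mul (hβfc.measurable.mul hQm)
  -- bounds on `K`
  obtain ⟨Cβ, hCβ⟩ := exists_bound_comp_of_pos hKc (hfc.continuousOn)
    (fun z _ => hf.pos _ (le_max_right _ _) _ _) hβ'
  have hpoly : ∃ C : ℝ, ∃ k : ℕ, ∀ p ω, B p ω ≤ C * (1 + ‖p.1 - p.2‖) ^ k :=
    ⟨Cb, 0, fun p ω => by simpa using hCb p ω⟩
  obtain ⟨CQ, hCQ0, hCQ⟩ := hf.exists_abs_truncatedCollisionOp_le hδ hB0 hpoly T' hT' 0 0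
  have hQb : ∀ z ∈ K, |truncatedCollisionOp δ B (f (max z.1 0) z.2.1) z.2.2| ≤ CQ := by
    intro z hz
    have h := hCQ (max z.1 0) (by rw [max_eq_left (hKT' z hz).1.le]; exact (hKT' z hz).2) z.2.1 z.2.2
    refine h.trans ?_
    have h1 : (1 + ‖z.2.1‖) ^ (-((0 : ℕ) : ℝ)) * (1 + ‖z.2.2‖) ^ (-((0 : ℕ) : ℝ)) = 1 := by simp
    rw [h1, mul_one]
  have hKfin : volume K < ∞ := hKc.measure_lt_top
  have hint : IntegrableOn (fun z : ℝ × E × E => χ z.2.2 *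
      (β' (f (max z.1 0) z.2.1 z.2.2) * truncatedCollisionOp δ B (f (max z.1 0) z.2.1) z.2.2)) K volume := by
    refine Measure.integrableOn_of_bounded hKfin.ne hmeas.aestronglyMeasurable ?_ (M := |Cχ| * (|Cβ| * CQ))
    refine (ae_restrict_mem hKc.measurableSet).mono fun z hz => ?_
    rw [Real.norm_eq_abs, abs_mul, abs_mul]
    refine mul_le_mul ((hχ _).trans (le_abs_self _)) ?_ (by positivity) (abs_nonneg _)
    exact mul_le_mul ((hCβ z hz).trans (le_abs_self _)) (hQb z hz) (abs_nonneg _) (abs_nonneg _)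
  refine hint.congr_fun (fun z hz => ?_) hKc.measurableSet
  beta_reduce
  rw [max_eq_left (hKT' z hz).1.le]

/-- **The renormalised truncated equation in `𝒟'`** (CIP 1994 §5.3 proof of Lemma 5.3.12, p. 158:
"`{gₘⁿ}` satisfies the hypotheses of Lemma 5.3.9 (`Tgₘⁿ = Qₙ(fⁿ,fⁿ)` if `gₘⁿ < m`, `= 0`
otherwise)", here for smooth renormalisations and with a velocity cut-off). For an approximate
solution `f` of the truncated equation with a bounded DiPerna–Lions kernel, `δ ≥ 0`, `β`
differentiable on `(0,∞)` with continuous derivative `β'`, and a bounded measurable velocity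
weight `χ`:
`(∂ₜ + v·∇ₓ)(χ(v) β(f)) = χ(v) β'(f) Q̃_δ(f,f)` in `𝒟'((0,T) × E × E)`. [cite: CIPDiluteGases1994, §5.3 Lemma 5.3.12, proof (p. 158)] -/
theorem IsDiPernaLionsApproximateSolution.hasDistribTransportOn_renormalised
    (hf : IsDiPernaLionsApproximateSolution δ B f) (hBk : IsDiPernaLionsKernel B) {Cb : ℝ}
    (hCb : ∀ p ω, B p ω ≤ Cb) (hδ : 0 ≤ δ) {β β' : ℝ → ℝ} (hβ : ∀ y, 0 < y → HasDerivAt β (β' y) y)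
    (hβ' : ContinuousOn β' (Ioi 0)) {χ : E → ℝ} (hχm : Measurable χ) {Cχ : ℝ}
    (hχ : ∀ v, |χ v| ≤ Cχ) (T : ℝ) :
    HasDistribTransportOn (Ioo 0 T)
      (fun z : ℝ × E × E => χ z.2.2 * β (f z.1 z.2.1 z.2.2))
      (fun z : ℝ × E × E =>
        χ z.2.2 * (β' (f z.1 z.2.1 z.2.2) * truncatedCollisionOp δ B (f z.1 z.2.1) z.2.2)) := by
  have hβc : ContinuousOn β (Ioi 0) := fun y hy => (hβ y hy).continuousAt.continuousWithinAt
  refine hasDistribTransportOn_of_hasDerivAt_shearFlow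
    (hf.locallyIntegrableOn_renormalised hβc hχm hχ T)
    (hf.locallyIntegrableOn_renormalised_rhs hBk.measurable hBk.nonneg hCb hδ hβ' hχm hχ T)
    fun z s hs => ?_
  obtain ⟨hd, heq⟩ := hf.hasDerivAt_sharp hs.1 z.1 z.2
  have h1 : HasDerivAt (fun σ => β (f σ (z.1 + σ • z.2) z.2))
      (β' (f s (z.1 + s • z.2) z.2) * truncatedCollisionOp δ B (f s (z.1 + s • z.2)) z.2) s := by
    have := (hβ _ (hf.pos s hs.1.le _ _)).comp s hd
    rw [heq] at this
    exact this
  have h2 := h1.const_mul (χ z.2)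
  simpa [shearFlow] using h2

end Approx

end Literature.MathematicalPhysics.KineticTheory
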